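import Literature.MathematicalPhysics.QuantumLattice.LiebFluxPhaseRP
import HarnessLib

/-!
# Plaquette fluxes of the reflected configurations and the counting of `π`-plaquettes

Support file for the proof of Lieb's flux-phase theorem `Lieb1994_fluxPi_torus`
(`LiebFluxPhase.lean`; E. H. Lieb, PRL **73** (1994) 2158). Lieb's Theorem ("Flux `π` is optimal")
is the remark that in the symmetrised Hamiltonian `(H_L, Θ(H_L))` of the Lemma, "the statement
`K_R = Θ(K_L)` implies the flux `π` condition by (4)" for "each square face of `Λ` that intersects
`P`" [Lieb1994, p. 4], and flux `π` in every square follows by "repeated reflection in hyperplanes in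
the standard way" [Lieb1994, p. 2]. This file provides the bookkeeping behind both sentences for a
phase configuration `u σ x y` (unit complex numbers, `u σ y x = (u σ x y)^*`) on the even `L × L`
torus, `L ≥ 4`, and its symmetrisations `amplLL u`, `amplRR u` (`LiebFluxPhaseRP.lean`):

* `plaq u σ x` — the product of `u` around the elementary plaquette with lower-left corner `x`
  (flux `π` means `plaq = -1`), `piCount u` — the number of pairs `(σ, x)` with flux `π`;
* the columns of plaquettes are interior-left (`IsIntL`), cut by `P` (`IsCut`) or interior-right
  (`IsIntR`); on interior-left plaquettes `amplLL u` has the fluxes of `u`, on CUT plaquettes it has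
  flux `π` (`plaq_amplLL_of_isCut` — Lieb's sentence, in the gauge `u(l, r) = 1`), and on
  interior-right plaquettes the conjugate flux of the mirror plaquette of `u` (`plaq_amplLL_of_isIntR`,
  mirror map `psi`, an involution exchanging the two interiors); symmetrically for `amplRR u`;
* the **counting inequality** `piCount_symm_add`: if some cut plaquette of `u` does not carry flux
  `π`, then `piCount (amplLL u) + piCount (amplRR u) ≥ 2 piCount u + 2`, so one of the two
  reflections strictly increases the number of `π`-plaquettes (the extremal form of "repeated
  reflection").

## References

* [Lieb1994] E. H. Lieb, Phys. Rev. Lett. 73 (1994) 2158, Theorem (p. 4) and p. 2.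
-/

noncomputable section

namespace Literature.MathematicalPhysics.QuantumLattice

open Finset FermionTorus

namespace LiebRP

attribute [local instance] decEqTorus

variable {L : ℕ} [NeZero L]

/-- A phase configuration. [folklore] -/
abbrev Cfg (L : ℕ) : Type := Fin 2 → FermionTorus 2 L → FermionTorus 2 L → ℂ

/-! ### Plaquette products -/

/-- The product of the phases around the elementary plaquette with lower-left corner `x`:
`u(x, x+e₀) u(x+e₀, x+e₀+e₁) u(x+e₀+e₁, x+e₁) u(x+e₁, x)`; flux `Φ` means `plaq = e^{iΦ}`
[Lieb1994, p. 1: "`T` has flux `Φ` … if `∏ t = |∏ t| e^{iΦ}`"]. [cite: Lieb1994, p. 1] -/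
def plaq (u : Cfg L) (σ : Fin 2) (x : FermionTorus 2 L) : ℂ :=
  u σ x (shift x 0) * u σ (shift x 0) (shift (shift x 0) 1) * u σ (shift (shift x 0) 1) (shift x 1) *
    u σ (shift x 1) x

/-- The number of spin–plaquette pairs carrying flux `π`. [cite: Lieb1994, Theorem] -/
def piCount (u : Cfg L) : ℕ := (univ.filter fun p : Fin 2 × FermionTorus 2 L => plaq u p.1 p.2 = -1).card

/-! ### Commuting shifts and the mirror map -/

/-- Shifts in different directions commute. [folklore] -/
theorem shift_comm (x : FermionTorus 2 L) (μ ν : Fin 2) : shift (shift x μ) ν = shift (shift x ν) μ := by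
  apply toTorusSite_injective
  rw [toTorusSite_shift, toTorusSite_shift, toTorusSite_shift, toTorusSite_shift, add_right_comm]

/-- **The mirror map on plaquette corners**: `ψ x = R(x + e₀) = R x - e₀`; the reflection sends the
plaquette at `x` to the plaquette at `ψ x` (traversed backwards). [cite: Lieb1994, p. 3 (reflection `R`)] -/
def psi (x : FermionTorus 2 L) : FermionTorus 2 L := unshift (reflect x) 0

/-- `R(x + e₀) = ψ x`. [folklore] -/
theorem reflect_shift_zero_eq_psi (x : FermionTorus 2 L) : reflect (shift x 0) = psi x :=
  reflect_shift_zero x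

/-- `R x = ψ x + e₀`. [folklore] -/
theorem reflect_eq_shift_psi (x : FermionTorus 2 L) : reflect x = shift (psi x) 0 := by
  rw [psi, shift_unshift]

/-- `R(x + e₀ + e₁) = ψ x + e₁`. [folklore] -/
theorem reflect_shift_shift_eq (x : FermionTorus 2 L) : reflect (shift (shift x 0) 1) = shift (psi x) 1 := by
  rw [reflect_shift_one, reflect_shift_zero_eq_psi]

/-- `R(x + e₁) = ψ x + e₀ + e₁`. [folklore] -/
theorem reflect_shift_one_eq (x : FermionTorus 2 L) : reflect (shift x 1) = shift (shift (psi x) 0) 1 := by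
  rw [reflect_shift_one, reflect_eq_shift_psi]

/-- `ψ` is an involution. [folklore] -/
theorem psi_psi (x : FermionTorus 2 L) : psi (psi x) = x := by
  rw [psi, psi, reflect_unshift_zero, reflect_reflect, unshift_shift]

/-- The column of `x + e₀` away from the seam. [folklore] -/
theorem col_shift_zero_of_lt {x : FermionTorus 2 L} (h : col x + 1 < L) : col (shift x 0) = col x + 1 := by
  rw [col_shift_zero, Nat.mod_eq_of_lt (show 1 < L by omega), Nat.mod_eq_of_lt h]

/-- The column of the mirror corner: `col (ψ x) = L - 2 - col x` (for `col x + 2 ≤ L`). [folklore] -/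
theorem col_psi {x : FermionTorus 2 L} (h : col x + 2 ≤ L) : col (psi x) = L - 2 - col x := by
  rw [psi, col_unshift_zero, col_reflect, Nat.mod_eq_of_lt (show 1 < L by omega),
    show L - 1 + (L - 1 - col x) = (L - 2 - col x) + L by omega, Nat.add_mod_right,
    Nat.mod_eq_of_lt (show L - 2 - col x < L by omega)]

/-! ### The three kinds of plaquette columns -/

/-- Interior-left plaquettes: both columns `col x, col x + 1` in the left half. [cite: Lieb1994, p. 2] -/
def IsIntL (L : ℕ) (x : FermionTorus 2 L) : Prop := col x + 2 ≤ L / 2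

/-- Cut plaquettes: "square faces that intersect `P`", columns `L/2 - 1 | L/2` or `L - 1 | 0`.
[cite: Lieb1994, Theorem (p. 4)] -/
def IsCut (L : ℕ) (x : FermionTorus 2 L) : Prop := col x + 1 = L / 2 ∨ col x + 1 = L

/-- Interior-right plaquettes. [cite: Lieb1994, p. 2] -/
def IsIntR (L : ℕ) (x : FermionTorus 2 L) : Prop := L / 2 ≤ col x ∧ col x + 2 ≤ L

/-- Interior-left is decidable. [folklore] -/
instance instDecidablePredIsIntL (L : ℕ) : DecidablePred (IsIntL L) := fun x =>
  inferInstanceAs (Decidable (col x + 2 ≤ L / 2))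

/-- Cut is decidable. [folklore] -/
instance instDecidablePredIsCut (L : ℕ) : DecidablePred (IsCut L) := fun x =>
  inferInstanceAs (Decidable (col x + 1 = L / 2 ∨ col x + 1 = L))

/-- Interior-right is decidable. [folklore] -/
instance instDecidablePredIsIntR (L : ℕ) : DecidablePred (IsIntR L) := fun x =>
  inferInstanceAs (Decidable (L / 2 ≤ col x ∧ col x + 2 ≤ L))

omit [NeZero L] in
/-- Every plaquette column is of exactly one kind (`L` even, `L ≥ 4`). [folklore] -/
theorem isIntL_or_isCut_or_isIntR (hL : Even L) (x : FermionTorus 2 L) :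
    IsIntL L x ∨ IsCut L x ∨ IsIntR L x := by
  unfold IsIntL IsCut IsIntR
  have := col_lt x
  obtain ⟨k, rfl⟩ := hL
  omega

omit [NeZero L] in
/-- The kinds are exclusive. [folklore] -/
theorem not_isCut_of_isIntL (hL : Even L) {x : FermionTorus 2 L} (h : IsIntL L x) : ¬IsCut L x := by
  unfold IsIntL IsCut at *; have := col_lt x; obtain ⟨k, rfl⟩ := hL; omega

omit [NeZero L] in
/-- The kinds are exclusive. [folklore] -/
theorem not_isIntR_of_isIntL (hL : Even L) {x : FermionTorus 2 L} (h : IsIntL L x) : ¬IsIntR L x := by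
  unfold IsIntL IsIntR at *; have := col_lt x; obtain ⟨k, rfl⟩ := hL; omega

omit [NeZero L] in
/-- The kinds are exclusive. [folklore] -/
theorem not_isIntR_of_isCut (hL : Even L) {x : FermionTorus 2 L} (h : IsCut L x) : ¬IsIntR L x := by
  unfold IsCut IsIntR at *; have := col_lt x; obtain ⟨k, rfl⟩ := hL; omega

/-- `ψ` maps interior-right corners to interior-left corners. [folklore] -/
theorem isIntL_psi (hL : Even L) {x : FermionTorus 2 L} (h : IsIntR L x) : IsIntL L (psi x) := by
  unfold IsIntL IsIntR at *
  rw [col_psi h.2]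
  obtain ⟨k, rfl⟩ := hL
  omega

/-- `ψ` maps interior-left corners to interior-right corners. [folklore] -/
theorem isIntR_psi (hL : Even L) {x : FermionTorus 2 L} (h : IsIntL L x) : IsIntR L (psi x) := by
  unfold IsIntL IsIntR at *
  have hx : col x + 2 ≤ L := by omega
  rw [col_psi hx]
  obtain ⟨k, rfl⟩ := hL
  omega

/-! ### Corners of the three kinds of plaquettes -/

/-- The four corners of an interior-left plaquette are left sites. [folklore] -/
theorem corners_isLeft_of_isIntL {x : FermionTorus 2 L} (h : IsIntL L x) :
    IsLeft L x ∧ IsLeft L (shift x 0) ∧ IsLeft L (shift (shift x 0) 1) ∧ IsLeft L (shift x 1) := by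
  unfold IsIntL at h
  simp only [isLeft_iff, col_shift_one]
  rw [col_shift_zero_of_lt (by omega)]
  omega

/-- The four corners of an interior-right plaquette are right sites. [folklore] -/
theorem corners_not_isLeft_of_isIntR {x : FermionTorus 2 L} (h : IsIntR L x) :
    ¬IsLeft L x ∧ ¬IsLeft L (shift x 0) ∧ ¬IsLeft L (shift (shift x 0) 1) ∧ ¬IsLeft L (shift x 1) := by
  unfold IsIntR at h
  simp only [isLeft_iff, col_shift_one]
  rw [col_shift_zero_of_lt (by omega)]
  omega

/-- **The reflection maps a cut plaquette to itself**: for a cut plaquette at `x`, `R` exchanges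
`x ↔ x + e₀` and `x + e₁ ↔ x + e₀ + e₁`. [cite: Lieb1994, p. 4 (squares intersecting `P`)] -/
theorem reflect_corners_of_isCut (hL : Even L) (h4 : 4 ≤ L) {x : FermionTorus 2 L} (h : IsCut L x) :
    reflect x = shift x 0 ∧ reflect (shift x 0) = x ∧ reflect (shift (shift x 0) 1) = shift x 1 ∧
      reflect (shift x 1) = shift (shift x 0) 1 := by
  have key : reflect x = shift x 0 := by
    rcases h with h | h
    · exact reflect_eq_shift_of_col hL h
    · -- across the seam: `col x = L - 1` and `R x` has column `0 = col (x + e₀)`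
      have h0 : col (shift x 0) = 0 := by
        rw [col_shift_zero, Nat.mod_eq_of_lt (show 1 < L by omega), h, Nat.mod_self]
      have h1 := reflect_eq_unshift_of_col_zero h0
      rw [unshift_shift] at h1
      have h2 := congrArg reflect h1
      rw [reflect_reflect] at h2
      exact h2.symm
  refine ⟨key, ?_, ?_, ?_⟩
  · rw [← key, reflect_reflect]
  · rw [reflect_shift_one, ← key, reflect_reflect]
  · rw [reflect_shift_one, key]

/-- Sides of a cut plaquette of the first kind (`col x = L/2 - 1`). [folklore] -/
theorem corners_of_isCut_inl {x : FermionTorus 2 L} (h : col x + 1 = L / 2) :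
    IsLeft L x ∧ ¬IsLeft L (shift x 0) ∧ ¬IsLeft L (shift (shift x 0) 1) ∧ IsLeft L (shift x 1) ∧
      IsBoundary L x ∧ IsBoundary L (shift x 1) := by
  simp only [isLeft_iff, isBoundary_iff, col_shift_one]
  rw [col_shift_zero_of_lt (by omega)]
  omega

/-- Sides of a cut plaquette of the second kind (`col x = L - 1`). [folklore] -/
theorem corners_of_isCut_inr (h4 : 4 ≤ L) {x : FermionTorus 2 L} (h : col x + 1 = L) :
    ¬IsLeft L x ∧ IsLeft L (shift x 0) ∧ IsLeft L (shift (shift x 0) 1) ∧ ¬IsLeft L (shift x 1) ∧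
      IsBoundary L (shift x 0) ∧ IsBoundary L (shift (shift x 0) 1) := by
  have h0 : col (shift x 0) = 0 := by
    rw [col_shift_zero, Nat.mod_eq_of_lt (show 1 < L by omega), h, Nat.mod_self]
  simp only [isLeft_iff, isBoundary_iff, col_shift_one, h0, or_true, and_true]
  omega

/-! ### Plaquette products of the symmetrised configurations -/

section Plaq

variable {u : Cfg L}

omit [NeZero L] in
/-- A unit phase times its conjugate. [folklore] -/
theorem star_mul_self_of_norm (hu : ∀ σ x y, ‖u σ x y‖ = 1) (σ : Fin 2) (x y : FermionTorus 2 L) :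
    star (u σ x y) * u σ x y = 1 := by
  rw [Complex.star_def, mul_comm, Complex.mul_conj, Complex.normSq_eq_norm_sq, hu]
  norm_num

/-- **Interior-left plaquettes of `amplLL u` carry the fluxes of `u`.** [cite: Lieb1994, Theorem] -/
theorem plaq_amplLL_of_isIntL (σ : Fin 2) {x : FermionTorus 2 L} (h : IsIntL L x) :
    plaq (amplLL u) σ x = plaq u σ x := by
  obtain ⟨h1, h2, h3, h4'⟩ := corners_isLeft_of_isIntL h
  unfold plaq
  rw [amplLL_apply, amplLL_apply, amplLL_apply, amplLL_apply,
    if_neg (fun h : ¬IsLeft L x ∧ ¬IsLeft L (shift x 0) => h.1 h1),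
    if_neg (fun h : ¬IsLeft L (shift x 0) ∧ ¬IsLeft L (shift (shift x 0) 1) => h.1 h2),
    if_neg (fun h : ¬IsLeft L (shift (shift x 0) 1) ∧ ¬IsLeft L (shift x 1) => h.1 h3),
    if_neg (fun h : ¬IsLeft L (shift x 1) ∧ ¬IsLeft L x => h.1 h4')]

/-- **Interior-right plaquettes of `amplRR u` carry the fluxes of `u`.** [cite: Lieb1994, Theorem] -/
theorem plaq_amplRR_of_isIntR (σ : Fin 2) {x : FermionTorus 2 L} (h : IsIntR L x) :
    plaq (amplRR u) σ x = plaq u σ x := by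
  obtain ⟨h1, h2, h3, h4'⟩ := corners_not_isLeft_of_isIntR h
  unfold plaq
  rw [amplRR_apply, amplRR_apply, amplRR_apply, amplRR_apply,
    if_neg (fun h : IsLeft L x ∧ IsLeft L (shift x 0) => h1 h.1),
    if_neg (fun h : IsLeft L (shift x 0) ∧ IsLeft L (shift (shift x 0) 1) => h2 h.1),
    if_neg (fun h : IsLeft L (shift (shift x 0) 1) ∧ IsLeft L (shift x 1) => h3 h.1),
    if_neg (fun h : IsLeft L (shift x 1) ∧ IsLeft L x => h4' h.1)]

/-- **Interior-right plaquettes of `amplLL u` carry the conjugate fluxes of the mirror plaquettes of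
`u`** (`Θ(K_L) = -R(K_L)`: four sign changes cancel, the reflection reverses the orientation).
[cite: Lieb1994, eq. (4)] -/
theorem plaq_amplLL_of_isIntR (σ : Fin 2) {x : FermionTorus 2 L} (h : IsIntR L x) :
    plaq (amplLL u) σ x = star (plaq u σ (psi x)) := by
  obtain ⟨h1, h2, h3, h4'⟩ := corners_not_isLeft_of_isIntR h
  unfold plaq
  rw [amplLL_apply, amplLL_apply, amplLL_apply, amplLL_apply, if_pos (And.intro h1 h2), if_pos (And.intro h2 h3),
    if_pos (And.intro h3 h4'), if_pos (And.intro h4' h1), reflect_shift_shift_eq, reflect_shift_one_eq,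
    reflect_shift_zero_eq_psi, reflect_eq_shift_psi x, star_mul', star_mul', star_mul']
  ring

/-- **Interior-left plaquettes of `amplRR u` carry the conjugate fluxes of the mirror plaquettes of
`u`.** [cite: Lieb1994, eq. (4)] -/
theorem plaq_amplRR_of_isIntL (σ : Fin 2) {x : FermionTorus 2 L} (h : IsIntL L x) :
    plaq (amplRR u) σ x = star (plaq u σ (psi x)) := by
  obtain ⟨h1, h2, h3, h4'⟩ := corners_isLeft_of_isIntL h
  unfold plaq
  rw [amplRR_apply, amplRR_apply, amplRR_apply, amplRR_apply, if_pos (And.intro h1 h2), if_pos (And.intro h2 h3),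
    if_pos (And.intro h3 h4'), if_pos (And.intro h4' h1), reflect_shift_shift_eq, reflect_shift_one_eq,
    reflect_shift_zero_eq_psi, reflect_eq_shift_psi x, star_mul', star_mul', star_mul']
  ring

/-- **Cut plaquettes of `amplLL u` carry flux `π`** — "the statement `K_R = Θ(K_L)` implies the flux
`π` condition by (4)" — in Lieb's gauge `u(l, r) = 1` on the cut bonds. [cite: Lieb1994, Theorem (p. 4)] -/
theorem plaq_amplLL_of_isCut (hL : Even L) (h4 : 4 ≤ L) (hu : ∀ σ x y, ‖u σ x y‖ = 1)
    (hh : ∀ σ x y, u σ y x = star (u σ x y)) (hcut : ∀ σ x, IsBoundary L x → u σ x (reflect x) = 1)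
    (σ : Fin 2) {x : FermionTorus 2 L} (h : IsCut L x) : plaq (amplLL u) σ x = -1 := by
  obtain ⟨r1, r2, r3, r4⟩ := reflect_corners_of_isCut hL h4 h
  have hcut' : ∀ σ x, IsBoundary L x → u σ (reflect x) x = 1 := fun σ x hx => by
    rw [hh, hcut σ x hx, star_one]
  unfold plaq
  rw [amplLL_apply, amplLL_apply, amplLL_apply, amplLL_apply]
  rcases h with h | h
  · obtain ⟨h1, h2, h3, h4', hb1, hb4⟩ := corners_of_isCut_inl h
    have e1 : u σ x (shift x 0) = 1 := by rw [← r1]; exact hcut σ x hb1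
    have e3 : u σ (shift (shift x 0) 1) (shift x 1) = 1 := by rw [← r4]; exact hcut' σ _ hb4
    rw [if_neg (fun h : ¬IsLeft L x ∧ ¬IsLeft L (shift x 0) => h.1 h1), if_pos (And.intro h2 h3),
      if_neg (fun h : ¬IsLeft L (shift (shift x 0) 1) ∧ ¬IsLeft L (shift x 1) => h.2 h4'),
      if_neg (fun h : ¬IsLeft L (shift x 1) ∧ ¬IsLeft L x => h.1 h4'), r2, r3, e1, e3]
    linear_combination -(star_mul_self_of_norm hu σ (shift x 1) x)
  · obtain ⟨h1, h2, h3, h4', hb2, hb3⟩ := corners_of_isCut_inr h4 h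
    have e1 : u σ x (shift x 0) = 1 := by
      have := hcut' σ (shift x 0) hb2; rwa [r2] at this
    have e3 : u σ (shift (shift x 0) 1) (shift x 1) = 1 := by
      have := hcut σ (shift (shift x 0) 1) hb3; rwa [r3] at this
    rw [if_neg (fun h : ¬IsLeft L x ∧ ¬IsLeft L (shift x 0) => h.2 h2),
      if_neg (fun h : ¬IsLeft L (shift x 0) ∧ ¬IsLeft L (shift (shift x 0) 1) => h.1 h2),
      if_neg (fun h : ¬IsLeft L (shift (shift x 0) 1) ∧ ¬IsLeft L (shift x 1) => h.1 h3),
      if_pos (And.intro h4' h1), r1, r4, e1, e3]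
    linear_combination -(star_mul_self_of_norm hu σ (shift x 0) (shift (shift x 0) 1))

/-- **Cut plaquettes of `amplRR u` carry flux `π`.** [cite: Lieb1994, Theorem (p. 4)] -/
theorem plaq_amplRR_of_isCut (hL : Even L) (h4 : 4 ≤ L) (hu : ∀ σ x y, ‖u σ x y‖ = 1)
    (hh : ∀ σ x y, u σ y x = star (u σ x y)) (hcut : ∀ σ x, IsBoundary L x → u σ x (reflect x) = 1)
    (σ : Fin 2) {x : FermionTorus 2 L} (h : IsCut L x) : plaq (amplRR u) σ x = -1 := by
  obtain ⟨r1, r2, r3, r4⟩ := reflect_corners_of_isCut hL h4 h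
  have hcut' : ∀ σ x, IsBoundary L x → u σ (reflect x) x = 1 := fun σ x hx => by
    rw [hh, hcut σ x hx, star_one]
  unfold plaq
  rw [amplRR_apply, amplRR_apply, amplRR_apply, amplRR_apply]
  rcases h with h | h
  · obtain ⟨h1, h2, h3, h4', hb1, hb4⟩ := corners_of_isCut_inl h
    have e1 : u σ x (shift x 0) = 1 := by rw [← r1]; exact hcut σ x hb1
    have e3 : u σ (shift (shift x 0) 1) (shift x 1) = 1 := by rw [← r4]; exact hcut' σ _ hb4
    rw [if_neg (fun h : IsLeft L x ∧ IsLeft L (shift x 0) => h2 h.2),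
      if_neg (fun h : IsLeft L (shift x 0) ∧ IsLeft L (shift (shift x 0) 1) => h2 h.1),
      if_neg (fun h : IsLeft L (shift (shift x 0) 1) ∧ IsLeft L (shift x 1) => h3 h.1),
      if_pos (And.intro h4' h1), r1, r4, e1, e3]
    linear_combination -(star_mul_self_of_norm hu σ (shift x 0) (shift (shift x 0) 1))
  · obtain ⟨h1, h2, h3, h4', hb2, hb3⟩ := corners_of_isCut_inr h4 h
    have e1 : u σ x (shift x 0) = 1 := by
      have := hcut' σ (shift x 0) hb2; rwa [r2] at this
    have e3 : u σ (shift (shift x 0) 1) (shift x 1) = 1 := by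
      have := hcut σ (shift (shift x 0) 1) hb3; rwa [r3] at this
    rw [if_neg (fun h : IsLeft L x ∧ IsLeft L (shift x 0) => h1 h.1), if_pos (And.intro h2 h3),
      if_neg (fun h : IsLeft L (shift (shift x 0) 1) ∧ IsLeft L (shift x 1) => h4' h.2),
      if_neg (fun h : IsLeft L (shift x 1) ∧ IsLeft L x => h4' h.1), r2, r3, e1, e3]
    linear_combination -(star_mul_self_of_norm hu σ (shift x 1) x)

end Plaq

/-! ### Counting -/

/-- `π`-plaquettes of `u` with corner of kind `P`. [folklore] -/
def cnt (u : Cfg L) (P : FermionTorus 2 L → Prop) [DecidablePred P] : ℕ :=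
  ((univ.filter fun p : Fin 2 × FermionTorus 2 L => P p.2).filter fun p => plaq u p.1 p.2 = -1).card

/-- All spin–plaquette pairs with corner of kind `P`. [folklore] -/
def tot (P : FermionTorus 2 L → Prop) [DecidablePred P] : ℕ :=
  (univ.filter fun p : Fin 2 × FermionTorus 2 L => P p.2).card

/-- `cnt u P ≤ tot P`. [folklore] -/
theorem cnt_le_tot (u : Cfg L) (P : FermionTorus 2 L → Prop) [DecidablePred P] : cnt u P ≤ tot (L := L) P :=
  Finset.card_le_card (Finset.filter_subset _ _)

/-- A non-`π` plaquette of kind `P` makes the count strictly smaller than the total. [folklore] -/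
theorem cnt_lt_tot {u : Cfg L} {P : FermionTorus 2 L → Prop} [DecidablePred P] {σ : Fin 2} {x : FermionTorus 2 L}
    (hx : P x) (hne : plaq u σ x ≠ -1) : cnt u P < tot (L := L) P := by
  refine Finset.card_lt_card (Finset.filter_ssubset.2 ⟨(σ, x), ?_, hne⟩)
  simp [hx]

/-- If all plaquettes of kind `P` are `π`, the count is the total. [folklore] -/
theorem cnt_eq_tot {u : Cfg L} {P : FermionTorus 2 L → Prop} [DecidablePred P]
    (h : ∀ σ x, P x → plaq u σ x = -1) : cnt u P = tot (L := L) P := by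
  unfold cnt tot
  congr 1
  refine Finset.filter_true_of_mem fun p hp => ?_
  exact h p.1 p.2 (by simpa using hp)

/-- Pointwise equal plaquette products on kind `P` give equal counts. [folklore] -/
theorem cnt_congr {u v : Cfg L} {P : FermionTorus 2 L → Prop} [DecidablePred P]
    (h : ∀ σ x, P x → plaq u σ x = plaq v σ x) : cnt u P = cnt v P := by
  unfold cnt
  congr 1
  refine Finset.filter_congr fun p hp => ?_
  rw [h p.1 p.2 (by simpa using hp)]

/-- `star z = -1 ↔ z = -1`. [folklore] -/
theorem star_eq_neg_one_iff (z : ℂ) : star z = -1 ↔ z = -1 := by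
  constructor
  · intro h
    have := congrArg star h
    rwa [star_star, star_neg, star_one] at this
  · intro h
    rw [h, star_neg, star_one]

/-- **Transport of counts along the mirror map**: if on kind `P` the plaquettes of `v` are the
conjugates of the `ψ`-mirror plaquettes of `u`, and `ψ` maps `P` to `Q` and back, then
`cnt v P = cnt u Q`. [folklore] -/
theorem cnt_eq_of_mirror {u v : Cfg L} {P Q : FermionTorus 2 L → Prop} [DecidablePred P] [DecidablePred Q]
    (hPQ : ∀ x, P x → Q (psi x)) (hQP : ∀ x, Q x → P (psi x))
    (h : ∀ σ x, P x → plaq v σ x = star (plaq u σ (psi x))) : cnt v P = cnt u Q := by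
  unfold cnt
  refine Finset.card_bij' (fun p _ => (p.1, psi p.2)) (fun q _ => (q.1, psi q.2)) ?_ ?_ ?_ ?_
  · rintro ⟨σ, x⟩ hp
    simp only [Finset.mem_filter, Finset.mem_univ, true_and] at hp ⊢
    refine ⟨hPQ x hp.1, ?_⟩
    have := hp.2
    rwa [h σ x hp.1, star_eq_neg_one_iff] at this
  · rintro ⟨σ, y⟩ hq
    simp only [Finset.mem_filter, Finset.mem_univ, true_and] at hq ⊢
    refine ⟨hQP y hq.1, ?_⟩
    rw [h σ (psi y) (hQP y hq.1), psi_psi, star_eq_neg_one_iff]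
    exact hq.2
  · rintro ⟨σ, x⟩ _
    simp [psi_psi]
  · rintro ⟨σ, y⟩ _
    simp [psi_psi]

/-- The total count splits over the three kinds of columns. [folklore] -/
theorem piCount_eq_add (hL : Even L) (u : Cfg L) :
    piCount u = cnt u (IsIntL L) + cnt u (IsCut L) + cnt u (IsIntR L) := by
  unfold piCount cnt
  rw [Finset.filter_filter, Finset.filter_filter, Finset.filter_filter,
    ← Finset.card_union_of_disjoint, ← Finset.filter_or, ← Finset.card_union_of_disjoint, ← Finset.filter_or]
  · congr 1
    refine Finset.filter_congr fun p _ => ?_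
    have h3 := isIntL_or_isCut_or_isIntR hL p.2
    have e1 := fun h => not_isCut_of_isIntL hL (x := p.2) h
    have e2 := fun h => not_isIntR_of_isIntL hL (x := p.2) h
    have e3 := fun h => not_isIntR_of_isCut hL (x := p.2) h
    tauto
  · rw [Finset.disjoint_filter]
    rintro p _ (⟨h1, -⟩ | ⟨h1, -⟩) ⟨h2, -⟩
    · exact not_isIntR_of_isIntL hL h1 h2
    · exact not_isIntR_of_isCut hL h1 h2
  · rw [Finset.disjoint_filter]
    rintro p _ ⟨h1, -⟩ ⟨h2, -⟩
    exact not_isCut_of_isIntL hL h1 h2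

/-- **The counting inequality behind "repeated reflection"**: for a unit Hermitian configuration
in Lieb's gauge with a cut plaquette NOT carrying flux `π`, the two reflected configurations
together have at least `2 piCount u + 2` `π`-plaquettes; hence one of them has strictly more than
`u`. [cite: Lieb1994, Theorem (p. 4) and p. 2 ("repeated reflection in hyperplanes")] -/
theorem piCount_symm_add (hL : Even L) (h4 : 4 ≤ L) {u : Cfg L} (hu : ∀ σ x y, ‖u σ x y‖ = 1)
    (hh : ∀ σ x y, u σ y x = star (u σ x y)) (hcut : ∀ σ x, IsBoundary L x → u σ x (reflect x) = 1)
    {σ₀ : Fin 2} {x₀ : FermionTorus 2 L} (hx₀ : IsCut L x₀) (hbad : plaq u σ₀ x₀ ≠ -1) :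
    2 * piCount u + 2 ≤ piCount (amplLL u) + piCount (amplRR u) := by
  rw [piCount_eq_add hL u, piCount_eq_add hL (amplLL u), piCount_eq_add hL (amplRR u),
    -- `amplLL`
    cnt_congr (fun σ x hx => plaq_amplLL_of_isIntL (u := u) σ hx),
    cnt_eq_tot (fun σ x hx => plaq_amplLL_of_isCut hL h4 hu hh hcut σ hx),
    cnt_eq_of_mirror (fun x hx => isIntL_psi hL hx) (fun x hx => isIntR_psi hL hx)
      (fun σ x hx => plaq_amplLL_of_isIntR (u := u) σ hx),
    -- `amplRR`
    cnt_eq_of_mirror (fun x hx => isIntR_psi hL hx) (fun x hx => isIntL_psi hL hx)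
      (fun σ x hx => plaq_amplRR_of_isIntL (u := u) σ hx),
    cnt_eq_tot (fun σ x hx => plaq_amplRR_of_isCut hL h4 hu hh hcut σ hx),
    cnt_congr (fun σ x hx => plaq_amplRR_of_isIntR (u := u) σ hx)]
  have hlt := cnt_lt_tot (u := u) hx₀ hbad
  omega

end LiebRP

end Literature.MathematicalPhysics.QuantumLattice

end
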